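import Literature.MathematicalPhysics.QuantumFieldTheory.Balaban1983to89.B9Thm39ReadingCoords
import Literature.MathematicalPhysics.QuantumFieldTheory.Balaban1983to89.B9Thm39WholeBlkViaDatum

/-!
# `Balaban1983to89.B9Thm39ReadingAtLetters` — rows 15–16 of the N06 knit ([B9] Theorem 3.9 ⇒ Theorem 3.2): the carrier-kernel reading
# `KerReadsLeVia` DISCHARGED at def-Y's letters, and rows 15 ∧ 16 at `opsYOfLetters` ∕ `opsYOfRecord` with NO reading binder

T. Bałaban, *Propagators for lattice gauge theories in a background field*, Commun. Math. Phys. **99** (1985) 389–434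
[`Balaban1985BackgroundPropagators`, "B9"]; [4] = T. Bałaban, *Propagators and renormalization transformations for lattice gauge
theories. II*, Commun. Math. Phys. **96** (1984) 223–250 [`Balaban1984PropagatorsII`].

statement-level skeleton of published theorems with citation tags; proofs where landed; nothing here is a claim about the
Yang–Mills mass gap

THE PRINTED LOCI (verbatim).  [B9] p. 395: *"R(U) = I − G′(U)Q′\*(U)(Q′(U)G′(U)²Q′\*(U))⁻¹Q′(U)G′(U)"* (3.25);  p. 398, Theorem 3.2: *"|(Q′(U)G′²(U)Q′\*(U))⁻¹(y,
y′)| ≦ B₀(L^jη)^{−4}(L^{j′}η)^{−d}e^{−δ₀d(y,y′)}, y, y′ ∈ 𝔅 (y ∈ Λ_j, y′ ∈ Λ_{j′})"* (3.48);  p. 411: *"(Q′G′²Q′\*)⁻¹ = C₀(I − R)⁻¹ = Σ_{n=0}^∞ C₀Rⁿ"*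
(3.96);  p. 413, Theorem 3.9: *"… This theorem implies Theorem 3.2."*;  [4] p. 232, (2.51): *"|(Tλ)(x)| ≦ K(y, y′)|λ|, x ∈ B^j(y), supp λ ⊂ B^{j′}(y′)"*;
[4] p. 235, (2.69) (the block pairing);  [4] p. 248: *"… with sites replaced by bonds"*.

WHY THIS FILE (successor of `B9Thm39WholeBlk` ∕ `…Faces` ∕ `…Via`).  In n06-d's whole-statement certificate at def-Y's instance the rows 15–16 block carried
the READING HYPOTHESIS `hrdC : KerReadsLe (𝔬39 x) (ops x).Cinv (θ.d₆+1) cR39` (FILE 22) — the only binder of rows 15–16 that touches the genuine letter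
`C(U) = (Q′G′²Q′\*)⁻¹(U)` (def-Y `CY := XinvY ∘ liftMatY (diagonal cWtY)`), and, read at index bonds, met at the record only through a representative map
(`B9Thm39WholeBlkVia`).  THIS FILE DISCHARGES IT: with the carrier `X39 𝔸 i := 𝔅_blocks × Fin (dim_ℝ 𝔸)` (block map `blk39` = representative bond of the
block), the letter `L39 := realify39 (unit39 • XY parS G′ U)` (the genuine (Q′G′²Q′\*)(U), def-Y's `XY`, in print's units `G′ ↦ η²G′` and real
coordinates) and `π := repSite39`, the inequality `|Cinv.ker U c c′| ≦ cR39 · ((L^{j(c′)}η)^{d+1})⁻¹ · blockKer blk39 T (π c) (π c′)` HOLDS at every two-sided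
inverse T of L(U) — T is (Q′G′²Q′\*)⁻¹(U) in coordinates (uniqueness of inverses, `Module.End.isUnit_iff`), def-Y's `C(U)(δ ⊗ E) = cWtY •` it, the norm
of an `𝔸`-valued entry is within `cR39` of its coordinate block sum, which sits inside the fibres over the representatives, and `cWtY(β c′) · unit39 =
((L^{j′}η)^{d+1})⁻¹` EXACTLY (T8's kernel units ARE print's (L^{j′}η)^{−d} pairing weight).  Rows 15 ∧ 16 then follow at `opsYOfLetters N θ M⋆ 𝔏 𝔈` for every
`𝔏` with `𝔏.C = CY … 𝔏.parS 𝔏.Gp` (def-Y's `CovLettersY.withGAC`; `rfl` at `lettersYOfRecord`) from the pins and the printed-shape schemas ALONE, at the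
datum `EK39OfOpsBlkVia … (repSite39 …)` whose TERMS are read through the representatives too (`B9Thm39WholeBlkViaDatum`: no site reads an empty fibre —
referee ref-E's J2 on `B9Thm39WholeBlkFaces`).

* §3 `κ39`, `basis39`, ★ `X39`, ★ `blk39` (`blk39_beta`, `exists_blk39_eq_repSite39` — every bond's read fibre is non-empty), `unit39` (`unit39_pos`), `cWtY_pos`, ★ `cWtY_beta_mul_unit39`, ★ `L39`, `CY_deltaY_apply`.
* §4 ★★ `reading_le_of_letters` — the reading inequality at `operatorLayerYOfLetters 𝔸 G x 𝔏 𝔈` (generic finite-dimensional `𝔸`).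
* §5 at the record's carriers (`𝔸 = M_N(ℂ)`, `G = SU(N)`): ★ `kerReadsLeVia_opsYOfLetters` (`KerReadsLeVia` DISCHARGED), ★★ `t39_hksum_of_pins_opsYOfLetters`
  (rows 15 ∧ 16 at the datum `EK39OfOpsBlkVia … (repSite39 x.toKIdx)` from the pins `hEK39`, `hblk`, `hL`, `hC` and the schemas — NO reading binder, NO
  `cR`, no representative-map binder), ★★ `t39_hksum_of_pins_opsYOfRecord` (`hC` by `rfl`).

HONEST SCOPE.  Every Theorem-3.9 schema (`StaticOK39Blk`, `Locality39Blk`, `Local348Blk`, `Identities395Blk`, `Small285Blk`, `Factors389Blk`) stays a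
DISPLAYED hypothesis of printed shape about the carrier letters `𝔬39` (whose `L` is now the GENUINE (Q′G′²Q′\*)(U)); nothing of [B9] or [4] is asserted;
the discharge is finite-dimensional linear algebra plus the record's bookkeeping (`cWtY`, `W`, `nKT`, `β`, `lvl`).  NOT a node discharge, NOT summit
progress; count-neutral; one finite 𝕋⁴ programme — nothing continuum, nothing about the mass gap.  Cell `pub-ymgap` (HUMAN RULING D-0062), Track A node
N06 [B9], seat `pub-ymgap-dag-n06-j` (harness re-seat gen 5), 2026-08-27.
-/

namespace Literature.MathematicalPhysics.QuantumFieldTheory.Balaban1983to89.B9Thm39ReadingAtLetters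

open Literature.MathematicalPhysics.QuantumFieldTheory.Balaban1983to89
open Finset B9Thm34Inv B9Thm39Whole B9Thm39WholeBlk B9Thm39WholeBlkVia B9Thm39WholeBlkViaDatum B9Thm39ReadingCoords Node00

noncomputable section

/-! ## §3 The carrier at a member: blocks × real coordinates of `𝔸`, the letter `(Q′G′²Q′*)(U)` in print's units and coordinates, the weights -/

section Carrier

open B6SectADomainsV1 B6SectAOperatorsV1 B6KLevelCensusIndexV1 B6Ineq2142KLevelV1 B9GeoNormsKLevelV1
open B6Prop22KLevelTorusCensusEta B6Ineq268MultiLevelBox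

variable {𝔸 : Type} [NormedRing 𝔸] [NormedAlgebra ℂ 𝔸] [CompleteSpace 𝔸] [FiniteDimensional ℂ 𝔸]
variable {d ℓ : ℕ} {hd : 1 ≤ d + 1} {hL : Odd (ℓ + 1) ∧ 1 < ℓ + 1} {b₀ b₁ : ℝ}

variable (𝔸) in
/-- the real coordinate index of `𝔸` (`dim_ℝ 𝔸` of them; for `𝔸 = M_N(ℂ)`: `2N²`). [cite: Balaban1985BackgroundPropagators, p.389, dictionary] -/
abbrev κ39 : Type := Fin (Module.finrank ℝ 𝔸)

variable (𝔸) in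
/-- a real basis of `𝔸` (any; the constants depend on it, the statements do not). [cite: Balaban1985BackgroundPropagators, p.389, dictionary] -/
def basis39 : Module.Basis (κ39 𝔸) ℝ 𝔸 := Module.finBasis ℝ 𝔸

variable (𝔸) in
/-- ★ **THE CARRIER OF ROWS 15–16 AT A MEMBER**: `𝔅_blocks × (real coordinates of 𝔸)` — real-valued functions on it ARE the `𝔸`-valued block
functions (`coordEquiv39`). [cite: Balaban1985BackgroundPropagators, p.397 (𝔅) + p.389; Balaban1984PropagatorsII, (2.45) p.231] -/
abbrev X39 (i : KIdx d ℓ hd hL b₀ b₁) : Type := BlkY i × κ39 𝔸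

variable (𝔸) in
/-- ★ **THE BLOCK MAP OF THE CARRIER**: a coordinate over the block `s` sits over the REPRESENTATIVE BOND of `s` (so the fibre over `π c` contains all
coordinates of the carrier block `β c`). [cite: Balaban1984PropagatorsII, p.248 («sites replaced by bonds») + (2.45) p.231] -/
def blk39 (i : KIdx d ℓ hd hL b₀ b₁) : X39 𝔸 i → IBondY i := fun p => rep39 i p.1

omit [CompleteSpace 𝔸] [FiniteDimensional ℂ 𝔸] in
/-- the block map on a coordinate of a carrier block: `blk39 (β c, ·) = π c`. [cite: Balaban1984PropagatorsII, (2.45) p.231, bookkeeping] -/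
theorem blk39_beta (i : KIdx d ℓ hd hL b₀ b₁) (c : IBondY i) (k : κ39 𝔸) : blk39 𝔸 i (β i.hN i.D i.hk c, k) = repSite39 i c := rfl

omit [CompleteSpace 𝔸] in
/-- **EVERY SITE'S READ FIBRE IS NON-EMPTY** (referee ref-E's J2 condition, in the form the π-reading uses): the fibre of `blk39` over the representative
`π c` of ANY index bond `c` contains the coordinates of the carrier block `β c` (all `dim_ℝ 𝔸 > 0` of them) — no bond's (3.99) or (3.48) reading is taken
over an empty fibre.  (`blk39` is onto the representatives, not onto all bonds; nothing else is needed or claimed.)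
[cite: Balaban1984PropagatorsII, p.248 («sites replaced by bonds») + (2.45) p.231, bookkeeping] -/
theorem exists_blk39_eq_repSite39 [Nontrivial 𝔸] (i : KIdx d ℓ hd hL b₀ b₁) (c : IBondY i) :
    ∃ p : X39 𝔸 i, blk39 𝔸 i p = repSite39 i c :=
  ⟨(β i.hN i.D i.hk c, ⟨0, Module.finrank_pos⟩), rfl⟩

/-- **PRINT'S UNITS**: `G′ ↦ η²G′` makes `Q′G′²Q′*` carry `η⁴ = |c_f|^{d+1}·η^{4+(d+1)}·(pairing)`; precisely the factor `|c_f|^{d+1} ∕ η^{−(4+(d+1))}`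
(`η⁻¹ =` T8's `nKT`) that turns def-Y's weights `cWtY` into the pairing weight `(L^{j′}η)^{−(d+1)}` (`cWtY_beta_mul_unit39`).
[cite: Balaban1985BackgroundPropagators, (3.48) p.398; Balaban1984PropagatorsII, (2.69) p.235, dictionary] -/
def unit39 (i : KIdx d ℓ hd hL b₀ b₁) : ℝ := |i.cf| ^ (d + 1) / (((nKT (toKT i) : ℕ) : ℝ)) ^ (4 + (d + 1))

/-- `unit39 > 0`. [cite: Balaban1985BackgroundPropagators, (3.48) p.398, bookkeeping] -/
theorem unit39_pos (i : KIdx d ℓ hd hL b₀ b₁) : 0 < unit39 i :=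
  div_pos (pow_pos (abs_pos.2 i.hcf) _) (pow_pos (nKT_pos (toKT i)) _)

/-- def-Y's kernel weight is positive. [cite: Balaban1985BackgroundPropagators, (3.48) p.398, bookkeeping] -/
theorem cWtY_pos (i : KIdx d ℓ hd hL b₀ b₁) (s : BlkY i) : 0 < cWtY i s :=
  div_pos (pow_pos (nKT_pos (toKT i)) _) (W_pos i.D.toDomains s)

/-- ★ **THE WEIGHTS IDENTITY**: at a carrier block, def-Y's kernel weight times the unit factor IS the reciprocal pairing weight of the geometry of
record: `cWtY (β c) · unit39 = ((L^{j(c)}η)^{d+1})⁻¹` (`W(β c) = L^{(d+1)j(c)}` by `beta_level`, `len c = L^{j(c)}∕|c_f|`).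
[cite: Balaban1985BackgroundPropagators, (3.48) p.398 («(L^{j′}η)^{−d}»); Balaban1984PropagatorsII, (2.69) p.235] -/
theorem cWtY_beta_mul_unit39 (i : KIdx d ℓ hd hL b₀ b₁) (c : IBondY i) :
    cWtY i (β i.hN i.D i.hk c) * unit39 i = (vol (geo9K i) (d + 1) c)⁻¹ := by
  have hk1 : 1 ≤ i.k := le_trans (by norm_num) i.hk2
  have hn : (0 : ℝ) < ((nKT (toKT i) : ℕ) : ℝ) := nKT_pos (toKT i)
  have hcf : (0 : ℝ) < |i.cf| := abs_pos.2 i.hcf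
  have hL0 : (0 : ℝ) < ((ℓ + 1 : ℕ) : ℝ) := by positivity
  have hW : W i.D.toDomains (β i.hN i.D i.hk c) = ((((ℓ + 1 : ℕ) : ℝ)) ^ lvl i.hN i.D i.hk c) ^ (d + 1) := by
    rw [W_eq, ← beta_level i.hN i.D i.hk hk1 c]
    push_cast
    ring
  have hvol : vol (geo9K i) (d + 1) c = ((((ℓ + 1 : ℕ) : ℝ)) ^ lvl i.hN i.D i.hk c / |i.cf|) ^ (d + 1) := by
    unfold vol
    rw [geo9K_len_kGeo, B6KLevelCensusIndexV1.len_eq, Real.rpow_natCast]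
  rw [cWtY, unit39, hW, hvol, div_pow]
  field_simp

/-- ★ **THE LETTER `L(U) = (Q′G′²Q′*)(U)` OF (3.95) AT THE GENUINE OPERATOR**, in print's units and in real coordinates: `realify39 (unit39 • XY parS G′ U)`
(def-Y's `XY` = Q′(U)G′(U)²Q′*(U) on block functions). [cite: Balaban1985BackgroundPropagators, (3.25) p.395 + (3.95) p.411] -/
def L39 (i : KIdx d ℓ hd hL b₀ b₁) (parS : SiteParY 𝔸 i) (Gp : SiteOpY 𝔸 i) : CfgY 𝔸 i → Module.End ℝ (X39 𝔸 i → ℝ) :=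
  fun U => realify39 (basis39 𝔸) (((unit39 i : ℝ) : ℂ) • XY i parS Gp U)

omit [FiniteDimensional ℂ 𝔸] in
/-- def-Y's `C(U)` on a delta function: `C(U)(δ_{s′} ⊗ E)(s) = cWtY(s′) • (Q′G′²Q′*)⁻¹(U)(δ_{s′} ⊗ E)(s)`.
[cite: Balaban1985BackgroundPropagators, (3.48) p.398, bookkeeping] -/
theorem CY_deltaY_apply (i : KIdx d ℓ hd hL b₀ b₁) (parS : SiteParY 𝔸 i) (Gp : SiteOpY 𝔸 i) (U : CfgY 𝔸 i)
    (s s' : BlkY i) (E : 𝔸) :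
    CY i parS Gp U (deltaY s' E) s = ((cWtY i s' : ℝ) : ℂ) • XinvY i parS Gp U (deltaY s' E) s := by
  classical
  have hlift : liftMatY 𝔸 (Matrix.diagonal (cWtY i)) (deltaY s' E) = ((cWtY i s' : ℝ) : ℂ) • deltaY s' E := by
    funext t
    rw [liftMatY_apply, Pi.smul_apply, Finset.sum_eq_single s']
    · by_cases ht : t = s'
      · subst ht; simp [deltaY]
      · simp [deltaY, ht]
    · intro x _ hx; simp [deltaY, hx]
    · intro h; exact absurd (Finset.mem_univ _) h
  show XinvY i parS Gp U (liftMatY 𝔸 (Matrix.diagonal (cWtY i)) (deltaY s' E)) s = _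
  rw [hlift, map_smul, Pi.smul_apply]

/-- `Ring.inverse (c • a) = c⁻¹ • Ring.inverse a` for a non-zero scalar. [folklore] -/
private theorem ring_inverse_smul {V : Type} [AddCommGroup V] [Module ℂ V] (c : ℂ) (hc : c ≠ 0) (a : Module.End ℂ V) :
    Ring.inverse (c • a) = c⁻¹ • Ring.inverse a := by
  by_cases ha : IsUnit a
  · have h1 : (c • a) * (c⁻¹ • Ring.inverse a) = 1 := by
      rw [smul_mul_assoc, mul_smul_comm, smul_smul, mul_inv_cancel₀ hc, one_smul, Ring.mul_inverse_cancel a ha]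
    have h2 : (c⁻¹ • Ring.inverse a) * (c • a) = 1 := by
      rw [smul_mul_assoc, mul_smul_comm, smul_smul, inv_mul_cancel₀ hc, one_smul, Ring.inverse_mul_cancel a ha]
    exact (Ring.inverse_unit ⟨c • a, c⁻¹ • Ring.inverse a, h1, h2⟩)
  · have hca : ¬ IsUnit (c • a) := by
      intro hu
      apply ha
      have h1 : (c⁻¹ • (c • a)) * (c • Ring.inverse (c • a)) = 1 := by
        rw [smul_mul_assoc, mul_smul_comm, smul_smul, inv_mul_cancel₀ hc, one_smul, Ring.mul_inverse_cancel _ hu]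
      have h2 : (c • Ring.inverse (c • a)) * (c⁻¹ • (c • a)) = 1 := by
        rw [smul_mul_assoc, mul_smul_comm, smul_smul, mul_inv_cancel₀ hc, one_smul, Ring.inverse_mul_cancel _ hu]
      have : c⁻¹ • (c • a) = a := by rw [smul_smul, inv_mul_cancel₀ hc, one_smul]
      rw [← this]
      exact ⟨⟨_, _, h1, h2⟩, rfl⟩
    rw [Ring.inverse_non_unit _ ha, Ring.inverse_non_unit _ hca, smul_zero]

end Carrier

/-! ## §4 The reading DISCHARGED at def-Y's letters -/

section Discharge

open B6SectADomainsV1 B6SectAOperatorsV1 B6KLevelCensusIndexV1 B6Ineq2142KLevelV1 B9GeoNormsKLevelV1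
open B9PinMembersKLevelV1 B9PinCarriersKLevelV1

variable {𝔸 : Type} [NormedRing 𝔸] [NormedAlgebra ℂ 𝔸] [CompleteSpace 𝔸] [FiniteDimensional ℂ 𝔸] {G : Subgroup 𝔸ˣ}
variable {d ℓ : ℕ} {hd : 1 ≤ d + 1} {hL : Odd (ℓ + 1) ∧ 1 < ℓ + 1} {b₀ b₁ : ℝ} {Mstar : ℕ} {ι κ' : Type}
variable [∀ x : MemberY d ℓ hd hL b₀ b₁ Mstar, DecidableEq (geo9Y x).Site]

/-- ★★ **THE CARRIER-KERNEL READING OF ROWS 15–16 IS A THEOREM AT DEF-Y'S LETTERS.**  For any letters `𝔏` whose `C` is def-Y's `CY` built from the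
letters' own `parS`, `Gp` (`CovLettersY.withGAC_C`; `rfl` at `lettersYOfRecord`), and any Theorem-3.9 carrier letters `𝔬` over `X39` whose block map is
`blk39` and whose `L(U)` is `L39` (the genuine `(Q′G′²Q′*)(U)` in print's units and real coordinates): at every U at which `L(U)` has a two-sided
inverse `T`, for all index bonds `y, y′`,
`|(operatorLayerYOfLetters … 𝔏 𝔈).Cinv.ker U y y′| ≤ cR39 · ((L^{j(y′)}η)^{d+1})⁻¹ · blockKer blk39 T (π y) (π y′)`
— `T` is `(Q′G′²Q′*)⁻¹(U)` in coordinates (uniqueness of two-sided inverses, `Module.End.isUnit_iff`), def-Y's `C(U)(δ ⊗ E)` is `cWtY •` it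
(`CY_deltaY_apply`), the norm of an `𝔸`-valued entry is within `cR39` of its coordinate block sum (`norm_apply_deltaY_le`), that sum sits inside the
fibres over the representatives (`blk39_beta`), and `cWtY(β y′)·unit39 = ((L^{j′}η)^{d+1})⁻¹` (`cWtY_beta_mul_unit39`).
[cite: Balaban1985BackgroundPropagators, Thm 3.2 (3.48) p.398 + (3.25) p.395 + (3.96) p.411; Balaban1984PropagatorsII, (2.51) p.232 + p.248] -/
theorem reading_le_of_letters (x : MemberY d ℓ hd hL b₀ b₁ Mstar) (𝔏 : CovLettersY 𝔸 x) (𝔈 : ExpLettersY 𝔸 G x)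
    (hC : 𝔏.C = CY x.toKIdx 𝔏.parS 𝔏.Gp)
    (𝔬 : Ops39Blk (geo9Y x) (bg9Y 𝔸 G x) (X39 𝔸 x.toKIdx) ι κ')
    (hblk : 𝔬.blk = blk39 𝔸 x.toKIdx) (hL : 𝔬.L = L39 x.toKIdx 𝔏.parS 𝔏.Gp)
    (U : (bg9Y 𝔸 G x).Cfg) (T : Module.End ℝ (X39 𝔸 x.toKIdx → ℝ)) (hTL : T * 𝔬.L U = 1) (hLT : 𝔬.L U * T = 1)
    (y y' : (geo9Y x).Site) :
    |(operatorLayerYOfLetters 𝔸 G x 𝔏 𝔈).Cinv.ker U y y'| ≤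
      cR39 (basis39 𝔸) * (vol (geo9Y x) (d + 1) y')⁻¹ * blockKer 𝔬.blk T (repSite39 x.toKIdx y) (repSite39 x.toKIdx y') := by
  classical
  set b := basis39 𝔸 with hb
  set u : ℂ := ((unit39 x.toKIdx : ℝ) : ℂ) with hu
  have hu0 : u ≠ 0 := by rw [hu]; exact_mod_cast (unit39_pos x.toKIdx).ne'
  set A : (BlkY x.toKIdx → 𝔸) →ₗ[ℂ] (BlkY x.toKIdx → 𝔸) := u • XY x.toKIdx 𝔏.parS 𝔏.Gp U with hA
  have hLU : 𝔬.L U = realify39 b A := by rw [hL]; rfl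
  -- `T` is a two-sided inverse of `realify A`; hence `A` is a unit and `T = realify (Ring.inverse A)`
  have hleft : ∀ f, T (realify39 b A f) = f := fun f => by
    have := LinearMap.congr_fun hTL f
    rwa [Module.End.mul_apply, hLU, Module.End.one_apply] at this
  have hright : ∀ f, realify39 b A (T f) = f := fun f => by
    have := LinearMap.congr_fun hLT f
    rwa [Module.End.mul_apply, hLU, Module.End.one_apply] at this
  have hbijR : Function.Bijective (realify39 b A) :=
    Function.bijective_iff_has_inverse.mpr ⟨T, hleft, hright⟩
  have hAeq : (A : (BlkY x.toKIdx → 𝔸) → (BlkY x.toKIdx → 𝔸)) = (coordEquiv39 b) ∘ (realify39 b A) ∘ (coordEquiv39 b).symm := by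
    funext g
    simp only [Function.comp_apply, realify39_apply, LinearEquiv.apply_symm_apply]
  have hbijA : Function.Bijective A := by
    rw [hAeq]
    exact (coordEquiv39 b).bijective.comp (hbijR.comp (coordEquiv39 b).symm.bijective)
  have hAunit : IsUnit A := (Module.End.isUnit_iff A).mpr hbijA
  have hT : T = realify39 b (Ring.inverse A) := by
    have e1 : realify39 b A * realify39 b (Ring.inverse A) = 1 := by
      rw [← realify39_mul, Ring.mul_inverse_cancel A hAunit, realify39_one]
    calc T = T * (realify39 b A * realify39 b (Ring.inverse A)) := by rw [e1, mul_one]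
      _ = (T * 𝔬.L U) * realify39 b (Ring.inverse A) := by rw [mul_assoc, hLU]
      _ = realify39 b (Ring.inverse A) := by rw [hTL, one_mul]
  have hXinv : XinvY x.toKIdx 𝔏.parS 𝔏.Gp U = u • Ring.inverse A := by
    rw [hA, ring_inverse_smul u hu0, smul_smul, mul_inv_cancel₀ hu0, one_smul]
    rfl
  -- the coordinate block sum sits inside the fibres over the representatives
  have hsum : ∑ c : κ39 𝔸, ∑ c' : κ39 𝔸, |entry T (β x.hN x.D x.hk y, c) (β x.hN x.D x.hk y', c')| ≤
      (Fintype.card (κ39 𝔸) : ℝ) * blockKer 𝔬.blk T (repSite39 x.toKIdx y) (repSite39 x.toKIdx y') := by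
    have hrow : ∀ c : κ39 𝔸, ∑ c' : κ39 𝔸, |entry T (β x.hN x.D x.hk y, c) (β x.hN x.D x.hk y', c')| ≤
        blockKer 𝔬.blk T (repSite39 x.toKIdx y) (repSite39 x.toKIdx y') := by
      intro c
      have hsub : ∑ c' : κ39 𝔸, |entry T (β x.hN x.D x.hk y, c) (β x.hN x.D x.hk y', c')| ≤
          ∑ x' ∈ univ.filter (fun x' => 𝔬.blk x' = repSite39 x.toKIdx y'), |entry T (β x.hN x.D x.hk y, c) x'| := by
        have hre : ∑ c' : κ39 𝔸, |entry T (β x.hN x.D x.hk y, c) (β x.hN x.D x.hk y', c')| =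
            ∑ x' ∈ univ.map ⟨fun c' : κ39 𝔸 => ((β x.hN x.D x.hk y', c') : X39 𝔸 x.toKIdx), fun a b h => by simpa using h⟩,
              |entry T (β x.hN x.D x.hk y, c) x'| := by
          rw [Finset.sum_map]; rfl
        rw [hre]
        refine Finset.sum_le_sum_of_subset_of_nonneg ?_ (fun _ _ _ => abs_nonneg _)
        intro x' hx'
        obtain ⟨c', -, rfl⟩ := Finset.mem_map.1 hx'
        simp [hblk, blk39_beta]
      refine hsub.trans ?_
      have hmem : 𝔬.blk ((β x.hN x.D x.hk y, c) : X39 𝔸 x.toKIdx) = repSite39 x.toKIdx y := by rw [hblk]; rfl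
      exact le_ciSup (f := fun xx : {xx : X39 𝔸 x.toKIdx // 𝔬.blk xx = repSite39 x.toKIdx y} =>
          ∑ x' ∈ univ.filter (fun x' => 𝔬.blk x' = repSite39 x.toKIdx y'), |entry T xx.1 x'|)
        (Set.finite_range _).bddAbove ⟨(β x.hN x.D x.hk y, c), hmem⟩
    calc ∑ c : κ39 𝔸, ∑ c' : κ39 𝔸, |entry T (β x.hN x.D x.hk y, c) (β x.hN x.D x.hk y', c')|
        ≤ ∑ _c : κ39 𝔸, blockKer 𝔬.blk T (repSite39 x.toKIdx y) (repSite39 x.toKIdx y') := Finset.sum_le_sum fun c _ => hrow c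
      _ = (Fintype.card (κ39 𝔸) : ℝ) * blockKer 𝔬.blk T (repSite39 x.toKIdx y) (repSite39 x.toKIdx y') := by
          rw [Finset.sum_const, Finset.card_univ, nsmul_eq_mul]
  -- the pointwise bound for every direction E of the unit ball
  have hw : 0 < cWtY x.toKIdx (β x.hN x.D x.hk y') := cWtY_pos x.toKIdx _
  have hbk : 0 ≤ blockKer 𝔬.blk T (repSite39 x.toKIdx y) (repSite39 x.toKIdx y') := blockKer_nonneg _ _ _ _
  have hcb : 0 ≤ coordBound39 b := norm_nonneg _
  have hbb : 0 ≤ basisBound39 b := Finset.sum_nonneg fun _ _ => norm_nonneg _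
  have hpt : ∀ E : BallY 𝔸, ‖𝔏.C U (deltaY (β x.hN x.D x.hk y') (E : 𝔸)) (β x.hN x.D x.hk y)‖ ≤
      cR39 b * (vol (geo9Y x) (d + 1) y')⁻¹ * blockKer 𝔬.blk T (repSite39 x.toKIdx y) (repSite39 x.toKIdx y') := by
    intro E
    have hE : ‖(E : 𝔸)‖ ≤ 1 := mem_closedBall_zero_iff.1 E.2
    have hO := norm_apply_deltaY_le b (Ring.inverse A) (β x.hN x.D x.hk y) (β x.hN x.D x.hk y') hE
    rw [← hT] at hO
    rw [hC, CY_deltaY_apply, hXinv, LinearMap.smul_apply, Pi.smul_apply, smul_smul, norm_smul]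
    have hnorm : ‖((cWtY x.toKIdx (β x.hN x.D x.hk y') : ℝ) : ℂ) * u‖ = cWtY x.toKIdx (β x.hN x.D x.hk y') * unit39 x.toKIdx := by
      rw [hu, ← Complex.ofReal_mul, Complex.norm_real, Real.norm_eq_abs, abs_of_pos (mul_pos hw (unit39_pos x.toKIdx))]
    rw [hnorm, cWtY_beta_mul_unit39]
    change (vol (geo9Y x) (d + 1) y')⁻¹ * ‖(Ring.inverse A) (deltaY (β x.hN x.D x.hk y') (E : 𝔸)) (β x.hN x.D x.hk y)‖ ≤ _
    have hvol : 0 ≤ (vol (geo9Y x) (d + 1) y')⁻¹ :=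
      inv_nonneg.2 (Real.rpow_nonneg (B6KLevelCensusIndexV1.len_pos x.toKIdx y').le _)
    calc (vol (geo9Y x) (d + 1) y')⁻¹ * ‖(Ring.inverse A) (deltaY (β x.hN x.D x.hk y') (E : 𝔸)) (β x.hN x.D x.hk y)‖
        ≤ (vol (geo9Y x) (d + 1) y')⁻¹ * (coordBound39 b * basisBound39 b *
            ∑ c : κ39 𝔸, ∑ c' : κ39 𝔸, |entry T (β x.hN x.D x.hk y, c) (β x.hN x.D x.hk y', c')|) :=
          mul_le_mul_of_nonneg_left hO hvol
      _ ≤ (vol (geo9Y x) (d + 1) y')⁻¹ * (coordBound39 b * basisBound39 b *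
            ((Fintype.card (κ39 𝔸) : ℝ) * blockKer 𝔬.blk T (repSite39 x.toKIdx y) (repSite39 x.toKIdx y'))) :=
          mul_le_mul_of_nonneg_left (mul_le_mul_of_nonneg_left hsum (mul_nonneg hcb hbb)) hvol
      _ = cR39 b * (vol (geo9Y x) (d + 1) y')⁻¹ * blockKer 𝔬.blk T (repSite39 x.toKIdx y) (repSite39 x.toKIdx y') := by
          rw [cR39]; ring
  haveI : Nonempty (BallY 𝔸) := ballY_nonempty
  have hsup : (⨆ E : BallY 𝔸, ‖𝔏.C U (deltaY (β x.hN x.D x.hk y') (E : 𝔸)) (β x.hN x.D x.hk y)‖) ≤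
      cR39 b * (vol (geo9Y x) (d + 1) y')⁻¹ * blockKer 𝔬.blk T (repSite39 x.toKIdx y) (repSite39 x.toKIdx y') := ciSup_le hpt
  have hker : (operatorLayerYOfLetters 𝔸 G x 𝔏 𝔈).Cinv.ker U y y' =
      ⨆ E : BallY 𝔸, ‖𝔏.C U (deltaY (β x.hN x.D x.hk y') (E : 𝔸)) (β x.hN x.D x.hk y)‖ := rfl
  rw [hker, abs_of_nonneg (Real.iSup_nonneg fun E => norm_nonneg _)]
  exact hsup

end Discharge

/-! ## §5 At the record's carriers: the reading DISCHARGED at `opsYOfLetters`, rows 15 ∧ 16 with NO reading binder -/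

section StageY

open scoped Matrix.Norms.L2Operator
open B9PinMembersKLevelV1 B9PinCarriersKLevelV1 B9PinGeometryKLevelV1 B7Prop2SpecialUnitary

variable {N : ℕ} (θ : Stage3Params) (Mstar : ℕ) (𝔏 : LettersY N θ Mstar) (𝔈 : ExpsY N θ Mstar)
variable [∀ x : MemberY θ.d₆ θ.ℓ₆ θ.hd' θ.hL' θ.b₀ θ.b₁ Mstar, Fintype (geo9Y x).Site]
  [∀ x : MemberY θ.d₆ θ.ℓ₆ θ.hd' θ.hL' θ.b₀ θ.b₁ Mstar, DecidableEq (geo9Y x).Site]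
variable {ι κ : MemberY θ.d₆ θ.ℓ₆ θ.hd' θ.hL' θ.b₀ θ.b₁ Mstar → Type} [∀ x, Fintype (ι x)]

omit [∀ x : MemberY θ.d₆ θ.ℓ₆ θ.hd' θ.hL' θ.b₀ θ.b₁ Mstar, Fintype (geo9Y x).Site] [∀ x, Fintype (ι x)] in
/-- ★ **`KerReadsLeVia` DISCHARGED AT def-Y's OPERATOR LAYER `opsYOfLetters N θ M⋆ 𝔏 𝔈`** for every letters family with `(𝔏 x).C = CY … (𝔏 x).parS (𝔏 x).Gp`
and every family of Theorem-3.9 carrier letters over `X39` pinned to `blk39` ∕ `L39`: the reading through the representatives `repSite39` with the constant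
`cR39 (basis39 M_N(ℂ))`. [cite: Balaban1985BackgroundPropagators, Thm 3.2 (3.48) p.398 + (3.25) p.395 + (3.96) p.411; Balaban1984PropagatorsII, (2.51) p.232 + p.248] -/
theorem kerReadsLeVia_opsYOfLetters
    (hC : ∀ x : MemberY θ.d₆ θ.ℓ₆ θ.hd' θ.hL' θ.b₀ θ.b₁ Mstar, (𝔏 x).C = CY x.toKIdx (𝔏 x).parS (𝔏 x).Gp)
    (𝔬39 : ∀ x : MemberY θ.d₆ θ.ℓ₆ θ.hd' θ.hL' θ.b₀ θ.b₁ Mstar,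
      Ops39Blk (geo9Y x) (bg9Y (Matrix (Fin N) (Fin N) ℂ) (specialUnitaryUnits (Fin N)) x) (X39 (Matrix (Fin N) (Fin N) ℂ) x.toKIdx) (ι x) (κ x))
    (hblk : ∀ x, (𝔬39 x).blk = blk39 (Matrix (Fin N) (Fin N) ℂ) x.toKIdx)
    (hL : ∀ x, (𝔬39 x).L = L39 x.toKIdx (𝔏 x).parS (𝔏 x).Gp) (x : MemberY θ.d₆ θ.ℓ₆ θ.hd' θ.hL' θ.b₀ θ.b₁ Mstar) :
    KerReadsLeVia (𝔬39 x) ((opsYOfLetters N θ Mstar 𝔏 𝔈) x).Cinv (θ.d₆ + 1) (cR39 (basis39 (Matrix (Fin N) (Fin N) ℂ))) (repSite39 x.toKIdx) :=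
  fun U T hTL hLT y y' => reading_le_of_letters x (𝔏 x) (𝔈 x) (hC x) (𝔬39 x) (hblk x) (hL x) U T hTL hLT y y'

/-- ★★ **ROWS 15 ∧ 16 OF THE N06 KNIT AT def-Y's INSTANCE FROM THE PINS ALONE — NO READING BINDER, NO `cR`**: for every letters family `𝔏` with
`(𝔏 x).C = CY x.toKIdx (𝔏 x).parS (𝔏 x).Gp` and expansion letters `𝔈`, Theorem-3.9 carrier letters `𝔬39 x : Ops39Blk (geo9Y x) (bg9Y …) (X39 M_N(ℂ) x.toKIdx)
(ι x) (κ x)` read by `rd39`, pinned by `(𝔬39 x).blk = blk39 …`, `(𝔬39 x).L = L39 x.toKIdx (𝔏 x).parS (𝔏 x).Gp` (the GENUINE (Q′G′²Q′*)(U)) and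
`(ops x).EK39 = EK39OfOpsBlkVia (𝔬39 x) (rd39 x) (θ.d₆+1) (2(N₀·B₀)·rowConst261 geo9Y (α′r)) ((1−α′)r) (repSite39 x.toKIdx)` (terms AND kernel read through
the representatives), satisfying the printed-shape schemas: `B9.Thm39Printed … (fun x => (ops x).EK39)` ∧ `B9.RWKernelSumYields … (fun x => (ops x).EK39)
(fun x => (ops x).Cinv)` at `ops := opsYOfLetters N θ M⋆ 𝔏 𝔈`; [4] (2.61) by n06-i's `rowSum261_geo9Y`, the reading by `kerReadsLeVia_opsYOfLetters`, the
representatives' invariances by `len_repSite39` ∕ `dist_repSite39_left` ∕ `dist_repSite39_right`.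
[cite: Balaban1985BackgroundPropagators, Thm 3.9 (3.98)–(3.99) p.413 + Thm 3.2 (3.48) p.398 + (3.25) p.395; Balaban1984PropagatorsII, Lemma 2.1 (2.61) p.234 + (2.51) p.232 + p.248] -/
theorem t39_hksum_of_pins_opsYOfLetters
    (𝔬39 : ∀ x : MemberY θ.d₆ θ.ℓ₆ θ.hd' θ.hL' θ.b₀ θ.b₁ Mstar,
      Ops39Blk (geo9Y x) (bg9Y (Matrix (Fin N) (Fin N) ℂ) (specialUnitaryUnits (Fin N)) x) (X39 (Matrix (Fin N) (Fin N) ℂ) x.toKIdx) (ι x) (κ x))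
    (rd39 : ∀ x : MemberY θ.d₆ θ.ℓ₆ θ.hd' θ.hL' θ.b₀ θ.b₁ Mstar,
      WalkReading39 (bg9Y (Matrix (Fin N) (Fin N) ℂ) (specialUnitaryUnits (Fin N)) x) (ι x) (κ x))
    (α α' r δ₀ θ₀ B₀ N₀ a₁ M₁ : ℝ)
    (hα : 0 < α) (hα1 : α < 1) (hα'0 : 0 < α') (hα'1 : α' < 1) (hr : 0 < r) (hrδ : r ≤ δ₀) (hθ₀ : 0 ≤ θ₀) (hB₀ : 0 < B₀)
    (hN₀ : 0 ≤ N₀) (ha₁ : 0 < a₁) (hM₁ : 0 < M₁)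
    (hst : ∀ x, StaticOK39Blk (𝔬39 x) N₀) (hloc : ∀ x, Locality39Blk (𝔬39 x) (rd39 x))
    (h39 : ∀ x : MemberY θ.d₆ θ.ℓ₆ θ.hd' θ.hL' θ.b₀ θ.b₁ Mstar, M₁ ≤ (geo9Y x).M → ∀ α₀ : ℝ, 0 < α₀ → c35Y * (geo9Y x).M * α₀ ≤ a₁ →
      ∀ U : (bg9Y (Matrix (Fin N) (Fin N) ℂ) (specialUnitaryUnits (Fin N)) x).Cfg,
        (bg9Y (Matrix (Fin N) (Fin N) ℂ) (specialUnitaryUnits (Fin N)) x).Reg335 c35Y α₀ U →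
        Local348Blk (𝔬39 x) B₀ δ₀ U ∧ Identities395Blk (𝔬39 x) U ∧ Small285Blk (𝔬39 x) θ₀ r U ∧ Factors389Blk (𝔬39 x) θ₀ δ₀ U)
    (hC : ∀ x : MemberY θ.d₆ θ.ℓ₆ θ.hd' θ.hL' θ.b₀ θ.b₁ Mstar, (𝔏 x).C = CY x.toKIdx (𝔏 x).parS (𝔏 x).Gp)
    (hblk : ∀ x, (𝔬39 x).blk = blk39 (Matrix (Fin N) (Fin N) ℂ) x.toKIdx)
    (hL : ∀ x, (𝔬39 x).L = L39 x.toKIdx (𝔏 x).parS (𝔏 x).Gp)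
    (hEK39 : ∀ x : MemberY θ.d₆ θ.ℓ₆ θ.hd' θ.hL' θ.b₀ θ.b₁ Mstar, ((opsYOfLetters N θ Mstar 𝔏 𝔈) x).EK39 =
      EK39OfOpsBlkVia (𝔬39 x) (rd39 x) (θ.d₆ + 1)
        (2 * (N₀ * B₀) * B9RowSum261DefiniteFaces.rowConst261 (geo9Y (d := θ.d₆) (ℓ := θ.ℓ₆) (hd := θ.hd') (hL := θ.hL')
          (b₀ := θ.b₀) (b₁ := θ.b₁) (Mstar := Mstar)) (α' * r)) ((1 - α') * r) (repSite39 x.toKIdx)) :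
    B9.Thm39Printed (θ.d₆ + 1) c35Y geo9Y (bg9Y (Matrix (Fin N) (Fin N) ℂ) (specialUnitaryUnits (Fin N)))
        (fun x => ((opsYOfLetters N θ Mstar 𝔏 𝔈) x).EK39) ∧
      B9.RWKernelSumYields (θ.d₆ + 1) geo9Y (bg9Y (Matrix (Fin N) (Fin N) ℂ) (specialUnitaryUnits (Fin N)))
        (fun x => ((opsYOfLetters N θ Mstar 𝔏 𝔈) x).EK39) (fun x => ((opsYOfLetters N θ Mstar 𝔏 𝔈) x).Cinv) :=
  t39_hksum_of_pin_rowConst261BlkViaDatum (opsYOfLetters N θ Mstar 𝔏 𝔈) 𝔬39 rd39 (fun x => repSite39 x.toKIdx) (θ.d₆ + 1) α α' r δ₀ θ₀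
    B₀ N₀ a₁ M₁ (cR39 (basis39 (Matrix (Fin N) (Fin N) ℂ))) c35Y_pos hα hα1 hα'0 hα'1 hr hrδ hθ₀ hB₀ hN₀ ha₁ hM₁ (cR39_nonneg _) hst hloc
    (fun x y => len_repSite39 x.toKIdx y) (fun x y z => dist_repSite39_left x.toKIdx y z) (fun x z y => dist_repSite39_right x.toKIdx z y)
    h39 hEK39 (kerReadsLeVia_opsYOfLetters θ Mstar 𝔏 𝔈 hC 𝔬39 hblk hL)

/-- ★★ **ROWS 15 ∧ 16 AT THE LETTERS OF RECORD `opsYOfRecord N θ M⋆ 𝔈`** (def-Y `lettersYOfRecord`: `C := CY …` by `rfl`): the same from the pins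
`hblk`, `hL`, `hEK39` and the schemas — the rows' only contact with the genuine letter `C(U)`, the reading, is a THEOREM.
[cite: Balaban1985BackgroundPropagators, Thm 3.9 (3.98)–(3.99) p.413 + Thm 3.2 (3.48) p.398; Balaban1984PropagatorsII, Lemma 2.1 (2.61) p.234] -/
theorem t39_hksum_of_pins_opsYOfRecord
    (𝔬39 : ∀ x : MemberY θ.d₆ θ.ℓ₆ θ.hd' θ.hL' θ.b₀ θ.b₁ Mstar,
      Ops39Blk (geo9Y x) (bg9Y (Matrix (Fin N) (Fin N) ℂ) (specialUnitaryUnits (Fin N)) x) (X39 (Matrix (Fin N) (Fin N) ℂ) x.toKIdx) (ι x) (κ x))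
    (rd39 : ∀ x : MemberY θ.d₆ θ.ℓ₆ θ.hd' θ.hL' θ.b₀ θ.b₁ Mstar,
      WalkReading39 (bg9Y (Matrix (Fin N) (Fin N) ℂ) (specialUnitaryUnits (Fin N)) x) (ι x) (κ x))
    (α α' r δ₀ θ₀ B₀ N₀ a₁ M₁ : ℝ)
    (hα : 0 < α) (hα1 : α < 1) (hα'0 : 0 < α') (hα'1 : α' < 1) (hr : 0 < r) (hrδ : r ≤ δ₀) (hθ₀ : 0 ≤ θ₀) (hB₀ : 0 < B₀)
    (hN₀ : 0 ≤ N₀) (ha₁ : 0 < a₁) (hM₁ : 0 < M₁)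
    (hst : ∀ x, StaticOK39Blk (𝔬39 x) N₀) (hloc : ∀ x, Locality39Blk (𝔬39 x) (rd39 x))
    (h39 : ∀ x : MemberY θ.d₆ θ.ℓ₆ θ.hd' θ.hL' θ.b₀ θ.b₁ Mstar, M₁ ≤ (geo9Y x).M → ∀ α₀ : ℝ, 0 < α₀ → c35Y * (geo9Y x).M * α₀ ≤ a₁ →
      ∀ U : (bg9Y (Matrix (Fin N) (Fin N) ℂ) (specialUnitaryUnits (Fin N)) x).Cfg,
        (bg9Y (Matrix (Fin N) (Fin N) ℂ) (specialUnitaryUnits (Fin N)) x).Reg335 c35Y α₀ U →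
        Local348Blk (𝔬39 x) B₀ δ₀ U ∧ Identities395Blk (𝔬39 x) U ∧ Small285Blk (𝔬39 x) θ₀ r U ∧ Factors389Blk (𝔬39 x) θ₀ δ₀ U)
    (hblk : ∀ x, (𝔬39 x).blk = blk39 (Matrix (Fin N) (Fin N) ℂ) x.toKIdx)
    (hL : ∀ x, (𝔬39 x).L = L39 x.toKIdx (lettersYOfRecord N θ Mstar x).parS (lettersYOfRecord N θ Mstar x).Gp)
    (hEK39 : ∀ x : MemberY θ.d₆ θ.ℓ₆ θ.hd' θ.hL' θ.b₀ θ.b₁ Mstar, ((opsYOfRecord N θ Mstar 𝔈) x).EK39 =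
      EK39OfOpsBlkVia (𝔬39 x) (rd39 x) (θ.d₆ + 1)
        (2 * (N₀ * B₀) * B9RowSum261DefiniteFaces.rowConst261 (geo9Y (d := θ.d₆) (ℓ := θ.ℓ₆) (hd := θ.hd') (hL := θ.hL')
          (b₀ := θ.b₀) (b₁ := θ.b₁) (Mstar := Mstar)) (α' * r)) ((1 - α') * r) (repSite39 x.toKIdx)) :
    B9.Thm39Printed (θ.d₆ + 1) c35Y geo9Y (bg9Y (Matrix (Fin N) (Fin N) ℂ) (specialUnitaryUnits (Fin N)))
        (fun x => ((opsYOfRecord N θ Mstar 𝔈) x).EK39) ∧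
      B9.RWKernelSumYields (θ.d₆ + 1) geo9Y (bg9Y (Matrix (Fin N) (Fin N) ℂ) (specialUnitaryUnits (Fin N)))
        (fun x => ((opsYOfRecord N θ Mstar 𝔈) x).EK39) (fun x => ((opsYOfRecord N θ Mstar 𝔈) x).Cinv) :=
  t39_hksum_of_pins_opsYOfLetters θ Mstar (lettersYOfRecord N θ Mstar) 𝔈 𝔬39 rd39 α α' r δ₀ θ₀ B₀ N₀ a₁ M₁ hα hα1 hα'0 hα'1 hr hrδ
    hθ₀ hB₀ hN₀ ha₁ hM₁ hst hloc h39 (fun _ => rfl) hblk hL hEK39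

end StageY

end

end Literature.MathematicalPhysics.QuantumFieldTheory.Balaban1983to89.B9Thm39ReadingAtLetters
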